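import Summits.QuantumFields.BalabanUV.T4Continuum.Support.CovariantAveragingSummand
import Summits.QuantumFields.BalabanUV.T4Continuum.Support.CovariantBlockAveragingTower

/-!
# T⁴ programme, spine node NE2 (U1a) — THE BAŁABAN INSTANCE of the covariant-averaging summand `a·(Q_k(U)*Q_k(U) − Q_k*Q_k)`:
# `PerturbationLaws (Δ_a ⊗ 1) (k ↦ a·n_k^d·(Q_k(R_k)ᴴQ_k(R_k) − (Q_kᴴQ_k) ⊗ 1)) (J ⊗ 1) κ_Q (C₂^Q·L^{−k})` FROM the two averaging laws
# (tier B, row B3.b-inst of `t4/formal/NE2/LEAVES.md`; owner rulings R2/R9, CLAIMS.log l.5825/l.5996)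

NE2 formalisation swarm `b2b-balaban-t4-ne2-formalise-*`, leaf 01, file 2 (companion of `Support/CovariantAveragingSummand`, p208141).  Row B3.b-inst
= the owner's Gram law APPLIED to Bałaban's own objects: the inner averaging is the LINE-SUM block averaging `Q_k = B5Block118.QvOp (lev L k) M` that
sits inside `calDa`'s `a•(QvAdj * QvOp)` ([Balaban1984PropagatorsI] (1.18) p.20, (1.69) p.29), colour-lifted and isometrically normalised —
`CovariantBlockAveraging.Bfree L M k = √(n_k^d)·(Q_k ⊗ 1)` (row B3.a′, p208149) —, and the transport error is `Ecov L M R k = √(n_k^d)·(Q_k(R_k) − Q_k ⊗ 1)`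
for leaf-07's covariant `k`-fold averaging `QcovLev L M R k` (row B3.a, p207814: every fine bond variable parallel-transported to the base point of its
block along the contours (1.7) before the line sum, transporters `R` as DATA).  By `CovariantBlockAveraging.gram_eq` the Gram core of this pair IS
`n_k^d·(Q_k(R_k)ᴴQ_k(R_k) − (Q_kᴴQ_k) ⊗ 1)`, so the owner's `GramPerturbationLaw.perturbationLaws_gramPert` (p207658) over the colour-lifted King tower
(`KroneckerLift.freeTowerLaws_kron o (NE2PerturbedLayer.freeTowerLaws_king …)`, `γ′ = Cst`) yields the END THEOREM of the row in the shape fixed by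
owner ruling R2 — **`perturbationLaws_covariantAveraging_balaban`** — GENERIC IN THE TWO LAWS it consumes (typer's cut):
 * `hB : AveragingLaws (Δ_a ⊗ 1) (Bfree L M) (J ⊗ 1) 1 (k ↦ Cf·L^{−k})` — row B3.a′'s free inner-pairing law (`averagingLaws_Bfree`, `Cf = Cst d a` from the
   exact offset identity of `Support/LineAveragingPairing`, p208202; filed by leaf-06 as its file 2), and
 * `hE : AveragingLaws (Δ_a ⊗ 1) (Ecov L M R) (J ⊗ 1) ε (k ↦ Cδ·L^{−k})` — size `ε = card o·(e^{(d+1)α} − 1)` is row B3.a's `opNorm_Ecov_le`; the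
   sandwiched two-level pairings `Cδ·L^{−k}` are rows B3.b-conc (ii) (leaf-06, transporter level = node NE3's currency BY NAME) + B3.a′ (iii) (leaf-07);
with `κ_Q = kappaQ d a a ε = a·ε(2 + ε)·Cst(d,a)` and `C₂^Q = a·C2gram Cst 1 ε (2dCst) CJ Cf Cδ` EXPLICIT.  Then the η-RATE (**`towerLimitRate_covariantAveraging_balaban`**,
all `‖t‖κ_Q < 1`) and the physical value `t = 1` with the DISPLAYED small-field threshold `a·ε(2 + ε)·Cst(d,a) < 1` (**`covariantAveraging_balaban_rate`**);
and **`covariantAveraging_balaban_trivial`**: at `R = 1` the summand is `0` (`Qcov_one`) — the typed operator reduces to `calDa ⊗ 1`, BY CONSTRUCTION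
(trigger c5; no dictionary B0 asserted).

HONEST FRAMING (T4-DAG p. 1).  Model level in the sense of the swarm: transporters are DATA, GLOBAL small field (`κ_Q < 1`), finite torus, linear
layer, operator norm; the free operator is `Δ_a ⊗ 1` and ONLY its `aQ*Q` summand is covariantized here (the other two summands are rows B2/B4);
NOT [Balaban1985BackgroundPropagators] (3.16)/(3.26) as printed (no regions `Λ_j`, no Dirichlet holes; the composite (3.15) of one-step averagings of
AVERAGED backgrounds is replaced by leaf-07's canonical contours at one spacing — declared in p207814); rates / pairings / constants OURS; nothing printed
is a hypothesis; no `def … : Prop` fact; the two laws are DISPLAYED binders until their rows land; NE2 NOT proved; spine 0/9 unchanged; NOT infinite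
volume / mass gap / Clay / summit progress.  HONEST DEPENDENCY: continuum YM on T⁴ ⇐ BetaPertH ∧ nine spine estimates (0/9 proved); BetaPertH ⇐ (D1) ∧
(D4) ∧ CAP+tail; G-an2-4 gates asym, D1 and NE2/3/4.  ABSOLUTE RULE kept; no `sorry`.
-/

noncomputable section

open scoped BigOperators ComplexConjugate Matrix Matrix.Norms.L2Operator Kronecker
open Filter Topology

namespace Summit.QuantumFields.BalabanUV.T4Continuum.CovariantAveragingBalaban

open Literature.MathematicalPhysics.QuantumFieldTheory.Balaban1983to89.B5Prop11Plancherel (Cst Cst_nonneg)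
open Literature.MathematicalPhysics.QuantumFieldTheory.Balaban1983to89.B5Block118 (QvOp)
open Literature.MathematicalPhysics.QuantumFieldTheory.Balaban1983to89.B5G183RateUnitTower (lev lev_neZero)
open Summit.QuantumFields.BalabanUV.T4Continuum
open Summit.QuantumFields.BalabanUV.T4Continuum.CovariantAveragingTower (TowerLimitRate)
open Summit.QuantumFields.BalabanUV.T4Continuum.BalabanAveragedTowerUnit (idx Qlev)
open Summit.QuantumFields.BalabanUV.T4Continuum.BackgroundResolventTower
open Summit.QuantumFields.BalabanUV.T4Continuum.KingPairingPlantedLaw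
open Summit.QuantumFields.BalabanUV.T4Continuum.NE2PerturbedLayer
open Summit.QuantumFields.BalabanUV.T4Continuum.PerturbationAlgebra
open Summit.QuantumFields.BalabanUV.T4Continuum.KroneckerLift
open Summit.QuantumFields.BalabanUV.T4Continuum.GramPerturbationLaw
open Summit.QuantumFields.BalabanUV.T4Continuum.NE2ColourPerturbedLayer (opNorm_inv_calDalev_kron_le)
open Summit.QuantumFields.BalabanUV.T4Continuum.CovariantAveragingSummand (kappaQ kappaQ_ofReal)
open Summit.QuantumFields.BalabanUV.T4Continuum.CovariantBlockAveraging (Bfree QcovLev Ecov gram_eq Qcov_one)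

variable {d : ℕ} (L : ℕ) [NeZero L] (M : Fin d → ℕ) [hM : ∀ μ, NeZero (M μ)] (a : ℝ) (ha : 0 < a)
variable (o : Type*) [Fintype o] [DecidableEq o]

omit [NeZero L] in
/-- **THE GRAM PERTURBATION OF THE PAIR `(Bfree, Ecov)` IS BAŁABAN's SUMMAND**: `c·((B + E)ᴴ(B + E) − BᴴB)_k = c·n_k^d·(Q_k(R_k)ᴴQ_k(R_k) − (Q_kᴴQ_k) ⊗ 1)`
(row B3.a′'s `gram_eq`, packaged along the tower). [folklore] -/
theorem gramPert_Bfree_Ecov (R : (k : ℕ) → Fin d → (idx L M k → Matrix o o ℂ)) (c : ℂ) :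
    gramPert c (Bfree (o := o) L M) (Ecov L M R)
      = fun k => c • ((((lev L k : ℕ) : ℂ) ^ d) • ((QcovLev L M R k)ᴴ * QcovLev L M R k
          - ((QvOp (lev L k) M)ᴴ * QvOp (lev L k) M) ⊗ₖ (1 : Matrix o o ℂ))) := by
  funext k
  rw [gramPert, gramCore, gram_eq]

omit [NeZero L] in
/-- **AT THE TRIVIAL BACKGROUND THE SUMMAND VANISHES** (`R = 1`: `Q_k(1) = Q_k ⊗ 1` by `Qcov_one`), so the typed operator `Δ_a ⊗ 1 + P^Q` reduces to
`Δ_a ⊗ 1` BY CONSTRUCTION (trigger c5; no dictionary B0 is asserted). [folklore] -/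
theorem covariantAveraging_balaban_trivial (c : ℂ) (k : ℕ) :
    c • ((((lev L k : ℕ) : ℂ) ^ d) • ((QcovLev L M (fun _ _ _ => (1 : Matrix o o ℂ)) k)ᴴ * QcovLev L M (fun _ _ _ => (1 : Matrix o o ℂ)) k
        - ((QvOp (lev L k) M)ᴴ * QvOp (lev L k) M) ⊗ₖ (1 : Matrix o o ℂ))) = 0 := by
  have h1 : QcovLev L M (fun _ _ _ => (1 : Matrix o o ℂ)) k = QvOp (lev L k) M ⊗ₖ (1 : Matrix o o ℂ) := Qcov_one (lev L k) M _
  rw [h1, kron_conjTranspose, ← kron_mul, sub_self, smul_zero, smul_zero]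

/-- **THE END THEOREM OF ROW B3.b-inst (owner ruling R2's shape), GENERIC IN THE TWO AVERAGING LAWS**: the free inner-pairing law of the line-sum
averaging (`hB`, row B3.a′: `b = 1`, `f_k = Cf·L^{−k}`) and the laws of the transport error (`hE`, rows B3.a/B3.a′ (iii)/B3.b-conc: size `ε`, sandwiched
two-level pairings `Cδ·L^{−k}`) give (H-bd) and (H-cons) for Bałaban's covariant-averaging summand against the colour-lifted free tower:
`κ_Q = a·ε(2 + ε)·Cst(d,a)`, `C₂^Q = a·C2gram Cst 1 ε (2dCst) CJ Cf Cδ` (`C2gram` linear in `Cf`, `Cδ` and the free defects).  No limit, no rate sum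
inside; both laws DISPLAYED as binders until their rows land. [cite: Balaban1984PropagatorsI, (1.18) p.20, (1.69) p.29, Prop. 1.1 (1.89) p.33;
Balaban1985BackgroundPropagators, (3.16) p.393, (3.26) p.395 (where the summand enters); King1986, (2.10) p.653, p.664] [folklore] -/
theorem perturbationLaws_covariantAveraging_balaban {R : (k : ℕ) → Fin d → (idx L M k → Matrix o o ℂ)} {ε Cf Cδ : ℝ} (hε : 0 ≤ ε)
    (hB : AveragingLaws (fun k => calDalev L M a ha k ⊗ₖ (1 : Matrix o o ℂ)) (Bfree (o := o) L M)
      (fun k => JpcT L M k ⊗ₖ (1 : Matrix o o ℂ)) 1 (fun k => Cf * ((L : ℝ)⁻¹) ^ k))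
    (hE : AveragingLaws (fun k => calDalev L M a ha k ⊗ₖ (1 : Matrix o o ℂ)) (Ecov L M R)
      (fun k => JpcT L M k ⊗ₖ (1 : Matrix o o ℂ)) ε (fun k => Cδ * ((L : ℝ)⁻¹) ^ k)) :
    PerturbationLaws (fun k => calDalev L M a ha k ⊗ₖ (1 : Matrix o o ℂ))
      (fun k => (a : ℂ) • ((((lev L k : ℕ) : ℂ) ^ d) • ((QcovLev L M R k)ᴴ * QcovLev L M R k
          - ((QvOp (lev L k) M)ᴴ * QvOp (lev L k) M) ⊗ₖ (1 : Matrix o o ℂ))))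
      (fun k => JpcT L M k ⊗ₖ (1 : Matrix o o ℂ)) (kappaQ d a (a : ℂ) ε)
      (fun k => a * C2gram (Cst d a) 1 ε (2 * d * Cst d a) (CJ d a) Cf Cδ * ((L : ℝ)⁻¹) ^ k) := by
  have h := perturbationLaws_gramPert (freeTowerLaws_kron o (freeTowerLaws_king L M a ha)) (opNorm_inv_calDalev_kron_le L M a ha) hB hE (a : ℂ)
  rw [gramPert_Bfree_Ecov] at h
  have hna : ‖(a : ℂ)‖ = a := by rw [Complex.norm_real, Real.norm_of_nonneg ha.le]
  refine perturbationLaws_mono h (le_of_eq ?_) fun k => ?_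
  · rw [kappaQ]; ring
  · refine (mul_le_mul_of_nonneg_left (e2gram_le_geom (ρ := (L : ℝ)⁻¹) (C₀ := 2 * d * Cst d a) (C₁ := CJ d a) (Cf := Cf) (Cδ := Cδ)
      (Cst_nonneg d a) zero_le_one hε (fun k => le_rfl) (fun k => le_rfl) (fun k => le_rfl) (fun k => le_rfl) k) (norm_nonneg _)).trans
      (le_of_eq ?_)
    rw [hna]; ring

/-- **η-RATE OF THE BAŁABAN COVARIANT-AVERAGING COUPLING** (`L ≥ 2`, every `‖t‖·κ_Q < 1`): the lifted King-averaged unit-lattice covariances of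
`(Δ_a^{(k)} ⊗ 1 + t·a·n_k^d·(Q_k(R_k)ᴴQ_k(R_k) − (Q_kᴴQ_k) ⊗ 1))⁻¹` CONVERGE with `‖c_k(t) − c_∞(t)‖ ≤ Cpert(t)·L^{−k}/(1 − L^{−1})`; all orders in `t`.
[cite: King1986, Lemma 4.5 (4.32)/(4.38) p.674 (scalar resolvent template); Balaban1985BackgroundPropagators, (3.26) p.395] [folklore] -/
theorem towerLimitRate_covariantAveraging_balaban (hL : 2 ≤ L) {R : (k : ℕ) → Fin d → (idx L M k → Matrix o o ℂ)} {ε Cf Cδ : ℝ}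
    (hε : 0 ≤ ε)
    (hB : AveragingLaws (fun k => calDalev L M a ha k ⊗ₖ (1 : Matrix o o ℂ)) (Bfree (o := o) L M)
      (fun k => JpcT L M k ⊗ₖ (1 : Matrix o o ℂ)) 1 (fun k => Cf * ((L : ℝ)⁻¹) ^ k))
    (hE : AveragingLaws (fun k => calDalev L M a ha k ⊗ₖ (1 : Matrix o o ℂ)) (Ecov L M R)
      (fun k => JpcT L M k ⊗ₖ (1 : Matrix o o ℂ)) ε (fun k => Cδ * ((L : ℝ)⁻¹) ^ k))
    {t : ℂ} (ht : ‖t‖ * kappaQ d a (a : ℂ) ε < 1) :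
    TowerLimitRate (fun k => Qlev L M k ⊗ₖ (1 : Matrix o o ℂ)) ((L : ℝ) ^ d)
      (fun k => (calDalev L M a ha k ⊗ₖ (1 : Matrix o o ℂ)
        + t • ((a : ℂ) • ((((lev L k : ℕ) : ℂ) ^ d) • ((QcovLev L M R k)ᴴ * QcovLev L M R k
            - ((QvOp (lev L k) M)ᴴ * QvOp (lev L k) M) ⊗ₖ (1 : Matrix o o ℂ)))))⁻¹)
      (Cpert (kappaQ d a (a : ℂ) ε) (2 * d * Cst d a) (CJ d a) (a * C2gram (Cst d a) 1 ε (2 * d * Cst d a) (CJ d a) Cf Cδ) 0 t)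
      ((L : ℝ)⁻¹) := by
  have hL1 : (1 : ℝ) < L := by exact_mod_cast (lt_of_lt_of_le one_lt_two hL : 1 < L)
  have hr : (0 : ℝ) < (L : ℝ) ^ d := pow_pos (lt_trans zero_lt_one hL1) d
  refine towerLimitRate_perturbed hr (freeTowerLaws_kron o (freeTowerLaws_king L M a ha))
    (perturbationLaws_covariantAveraging_balaban L M a ha o hε hB hE) (inv_lt_one_of_one_lt₀ hL1)
    (fun k => le_rfl) (fun k => le_rfl) (fun k => le_rfl) (fun k => ?_) ht
  simp only [zero_mul, le_refl]

/-- **THE PHYSICAL VALUE `t = 1`** in the small-field regime `a·ε(2 + ε)·Cst(d,a) < 1` (threshold DISPLAYED): the lifted King-averaged unit-lattice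
covariances of `(Δ_a^{(k)} ⊗ 1 + a·n_k^d·(Q_k(R_k)ᴴQ_k(R_k) − (Q_kᴴQ_k) ⊗ 1))⁻¹` converge with rate `L^{−k}`. [folklore] -/
theorem covariantAveraging_balaban_rate (hL : 2 ≤ L) {R : (k : ℕ) → Fin d → (idx L M k → Matrix o o ℂ)} {ε Cf Cδ : ℝ} (hε : 0 ≤ ε)
    (hB : AveragingLaws (fun k => calDalev L M a ha k ⊗ₖ (1 : Matrix o o ℂ)) (Bfree (o := o) L M)
      (fun k => JpcT L M k ⊗ₖ (1 : Matrix o o ℂ)) 1 (fun k => Cf * ((L : ℝ)⁻¹) ^ k))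
    (hE : AveragingLaws (fun k => calDalev L M a ha k ⊗ₖ (1 : Matrix o o ℂ)) (Ecov L M R)
      (fun k => JpcT L M k ⊗ₖ (1 : Matrix o o ℂ)) ε (fun k => Cδ * ((L : ℝ)⁻¹) ^ k))
    (hsmall : a * (ε * (2 + ε) * Cst d a) < 1) :
    TowerLimitRate (fun k => Qlev L M k ⊗ₖ (1 : Matrix o o ℂ)) ((L : ℝ) ^ d)
      (fun k => (calDalev L M a ha k ⊗ₖ (1 : Matrix o o ℂ)
        + (a : ℂ) • ((((lev L k : ℕ) : ℂ) ^ d) • ((QcovLev L M R k)ᴴ * QcovLev L M R k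
            - ((QvOp (lev L k) M)ᴴ * QvOp (lev L k) M) ⊗ₖ (1 : Matrix o o ℂ))))⁻¹)
      (Cpert (kappaQ d a (a : ℂ) ε) (2 * d * Cst d a) (CJ d a) (a * C2gram (Cst d a) 1 ε (2 * d * Cst d a) (CJ d a) Cf Cδ) 0 1)
      ((L : ℝ)⁻¹) := by
  have h1 : ‖(1 : ℂ)‖ * kappaQ d a (a : ℂ) ε < 1 := by rwa [norm_one, one_mul, kappaQ_ofReal ha.le]
  have h := towerLimitRate_covariantAveraging_balaban L M a ha o hL hε hB hE h1
  simpa only [one_smul] using h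

end Summit.QuantumFields.BalabanUV.T4Continuum.CovariantAveragingBalaban

end
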